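import Literature.AlgebraicGeometry.Resolution.DerivativeIdealSheaf
import Literature.AlgebraicGeometry.Resolution.CoefficientIdeals
import Mathlib.Algebra.BigOperators.Group.Finset.Basic
import Mathlib.Algebra.Order.BigOperators.Group.Finset
import HarnessLib

/-!
# Tuning of ideals: `MC(I)`, `D`-balanced and `MC`-invariant ideals, maximal coefficient ideals `W_s(I)` (Kollár 2007, §§3.7–3.11)

Topic: `Literature/AlgebraicGeometry/Resolution`. Vocabulary for layer 4b of the decomposition
of the named fact `Hironaka1964` along J. Kollár, *Lectures on Resolution of Singularities*
(2007), Ch. 3 — the notions in which the proof of Thm. 3.103 (= the named fact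
`Kollar2007Thm3_103` of `KollarBlowupSequenceFunctors.lean`, §3.12) is phrased: Step 1 of 3.103
replaces `I` by the "tuned" ideal `W_{m!}(I)`, which is `D`-balanced (going up, Thm. 3.84) and
`MC`-invariant (uniqueness of maximal contact, Thm. 3.92), order reduction for `(X, I, E)` being
equivalent to order reduction for `(X, W_s(I), E)` (Cor. 3.101). DEFINITIONS with proved API,
at the ring level (an `R`-algebra `A` with the derivative ideals `𝒟ⁱ` of `DerivativeIdeals.lean`)
and at the sheaf level (ideal sheaves on a scheme with `k`-structure `φ`, the derivative ideal
sheaves `𝒟ⁱ` of `DerivativeIdealSheaf.lean`); throughout, the parameter `m` is meant to be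
`max-ord I` as in Kollár's definitions.

## Content (ring level)

* `derivIdeal_iSup`, `derivIdeal_sup` (`𝒟(⨆ Jᵢ) = ⨆ 𝒟(Jᵢ)`), `derivIdeal_mul_le` — **the product
  rule `𝒟(IJ) ⊆ I𝒟(J) + J𝒟(I)`** (Lemma 3.74 (2), `r = 1`), `derivIdeal_pow_succ_le`
  (`𝒟(I^{c+1}) ⊆ I^c 𝒟(I)`) — PROVED.
* `maxContactIdeal R I m = MC(I) := 𝒟^{m-1}(I)` (Def. 3.79) — an ALIAS (`abbrev`) of the tree's
  `tangentIdeal R I m` (BGMW Def. 3.6.5, `CoefficientIdeals.lean`), `maxContactIdeal_eq`;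
  `IsDBalanced R I m` (Def. 3.83: `(𝒟ⁱI)^m ⊆ I^{m-i}`, `i < m`); `IsMCInvariant R I m` (3.53 /
  §3.10: `MC(I)·𝒟(I) ⊆ I`) — DEFINITIONS.
* `coeffWeight m c = Σ (m - j) c_j`, `derivMonomial R I m c = ∏_{j ≤ m} (𝒟ʲI)^{c_j}`,
  `maxCoeffIdeal R I m s = W_s(I)` — **Def. 3.98, the maximal coefficient ideals** — DEFINITIONS;
  `maxCoeffIdeal_le_iff`, `coeffWeight_add`, `derivMonomial_mul`, `derivMonomial_single`,
  `coeffWeight_single`, `maxCoeffIdeal_zero` (`W_0 = A`).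
* **Prop. 3.99**: (1) `maxCoeffIdeal_antitone`; (2) `maxCoeffIdeal_mul_le`
  (`W_s·W_t ⊆ W_{s+t}`); (3) `⊆`: `derivIdeal_derivMonomial_le` (the product rule on a monomial:
  `𝒟(∏ (𝒟ʲI)^{c_j}) ⊆ W_{w-1}`), `derivIdeal_maxCoeffIdeal_succ_le` (`𝒟(W_{s+1}) ⊆ W_s`),
  `derivIdealIter_maxCoeffIdeal_add_le` (`𝒟ʲ(W_{s+j}) ⊆ W_s`); (4) `⊆`:
  `derivIdealIter_le_maxCoeffIdeal` (`𝒟ʲI ⊆ W_{m-j}`), `maxContactIdeal_le_maxCoeffIdeal_one`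
  (`MC(I) ⊆ W_1`), `maxContactIdeal_maxCoeffIdeal_le` (`MC(W_s) ⊆ W_1`); and
  `pow_le_maxCoeffIdeal` (`I^s ⊆ W_{ms}`, the bracket of Thm. 3.100) — PROVED.

## Content (sheaf level)

* `maxContactIdealSheaf φ I m`, `IsDBalancedSheaf φ I m`, `IsMCInvariantSheaf φ I m`,
  `derivMonomialSheaf φ I m c`, `maxCoeffIdealSheaf φ I m s` — the same notions for ideal sheaves
  (DEFINITIONS, in the `IdemCommSemiring` of `Scheme.IdealSheafData`).
* `idealSheafData_iSup_mul`, `idealSheafData_mul_iSup`, `idealSheafData_ideal_prod` [folklore];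
  `derivMonomialSheaf_ideal`, `maxCoeffIdealSheaf_ideal` — **`W_s(I)(U) = W_s(I(U))` on affine
  opens** (finitely presented differentials, `HasFinitePresentationDifferentials`, e.g. on a
  variety); `isMCInvariantSheaf_iff`, `isDBalancedSheaf_iff` (the sheaf notions are the ring
  notions on affine opens) — PROVED.
* Prop. 3.99 (1), (2), (3) `⊆` for sheaves: `maxCoeffIdealSheaf_antitone`,
  `maxCoeffIdealSheaf_mul_le`, `derivIdealSheaf_maxCoeffIdealSheaf_succ_le`;
  `pow_le_maxCoeffIdealSheaf` — PROVED.

Not proved here (characteristic zero and a local parameter `x_1 ∈ MC(I)` of order one are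
needed): the equalities in Prop. 3.99 (3)–(4), and (5)–(8) (`W_s` is `MC`-invariant;
`W_s·W_t = W_{s+t}` and `W_s` is `D`-balanced for `s = r·lcm(2,…,m)`, `r ≥ m - 1`, via
Claim 3.99.9); Thm. 3.100 / Cor. 3.101 (tuning) refer to all blow-up sequences and belong with the
blow-up sequence functors.

## Faithfulness notes

* Kollár's `D(I)` (Def. 3.73: the ideal generated by all derivatives `Der_X × I → 𝒪_X`) is
  rendered by `derivIdeal R I = I + (δ f : δ ∈ Der_R(A), f ∈ I)` / `derivIdealSheaf`
  (`DerivativeIdeals.lean`, `DerivativeIdealSheaf.lean`; on a smooth variety both are the ideal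
  generated by `I` and the `∂f/∂x_i`, and `I ⊆ D(I)` holds in Kollár's too, p. 152).
* `W_s(I) := (∏_{j=0}^m (DʲI)^{c_j} : Σ (m - j) c_j ≥ s)` is read as the ideal GENERATED by these
  products (`⨆` of the product ideals over the exponent vectors `c : Fin (m+1) → ℕ` of weight
  `≥ s`); the factor `j = m` has weight `0` (and `DᵐI = 𝒪_X` when `m = max-ord I`).
* `m` is a free parameter standing for `max-ord I`; statements using these notions supply
  `m = max-ord I` as a hypothesis.

## Sources

* J. Kollár, *Lectures on Resolution of Singularities*, Ann. of Math. Stud. 166, PUP 2007: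
  Def. 3.73, Lemma 3.74 (pp. 152–153); Def. 3.79 (p. 155); Def. 3.83 (p. 157); 3.53 (p. 142) and
  §3.10 (p. 163) (`MC`-invariant); Def. 3.98, Prop. 3.99 (pp. 166–167); Thm. 3.100, Cor. 3.101
  (pp. 167–169); Thm. 3.103 Step 1 (p. 171) — these `p.` are positions in the held copy (`lit read book:kollar2007-lectures-resolution-singularities --pages N`), offset from the printed pagination; the numbered items are the locators. [Kollar2007]
* E. Bierstone, D. Grigoriev, P. Milman, J. Włodarczyk, arXiv:1206.3090, Def. 3.5.1, Def. 3.6.5.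
  [BierstoneGrigorievMilmanWlodarczyk2011]
-/

namespace Literature.AlgebraicGeometry.Resolution

open scoped BigOperators

section Ring

variable (R : Type*) {A : Type*} [CommSemiring R] [CommRing A] [Algebra R A]

/-! ## Product rules for the derivative ideal (Kollár Lemma 3.74 (2), `r = 1`) -/

/-- `𝒟` of a supremum: `𝒟(⨆ Jᵢ) = ⨆ 𝒟(Jᵢ)`. [folklore] -/
theorem derivIdeal_iSup {ι : Sort*} (J : ι → Ideal A) :
    derivIdeal R (⨆ i, J i) = ⨆ i, derivIdeal R (J i) := by
  apply le_antisymm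
  · refine (derivIdeal_le_iff R).mpr ⟨iSup_mono fun i => le_derivIdeal R (J i), fun δ f hf => ?_⟩
    refine Submodule.iSup_induction (p := fun i => J i) (motive := fun f => δ f ∈ ⨆ i, derivIdeal R (J i)) hf
      (fun i f hf => ?_) (by simp) (fun f g hf hg => by rw [map_add]; exact Ideal.add_mem _ hf hg)
    exact Ideal.mem_iSup_of_mem i (apply_mem_derivIdeal R δ hf)
  · exact iSup_le fun i => derivIdeal_mono R (le_iSup J i)

/-- `𝒟` of a binary supremum. [folklore] -/
theorem derivIdeal_sup (I J : Ideal A) : derivIdeal R (I ⊔ J) = derivIdeal R I ⊔ derivIdeal R J := by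
  rw [sup_eq_iSup, derivIdeal_iSup, sup_eq_iSup]
  congr 1
  ext b
  cases b <;> rfl

/-- **The product rule** `𝒟(I·J) ⊆ I·𝒟(J) + J·𝒟(I)` (Kollár Lemma 3.74 (2) for `r = 1`:
`δ(fg) = f δg + g δf`). [cite: Kollar2007, Lemma 3.74 (2)] -/
theorem derivIdeal_mul_le (I J : Ideal A) :
    derivIdeal R (I * J) ≤ I * derivIdeal R J ⊔ J * derivIdeal R I := by
  refine (derivIdeal_le_iff R).mpr ⟨?_, fun δ f hf => ?_⟩
  · exact le_sup_of_le_left (Ideal.mul_mono_right (le_derivIdeal R J))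
  · refine Submodule.mul_induction_on hf (fun a ha b hb => ?_) (fun x y hx hy => ?_)
    · rw [Derivation.leibniz, smul_eq_mul, smul_eq_mul]
      exact Ideal.add_mem _ (Ideal.mem_sup_left (Ideal.mul_mem_mul ha (apply_mem_derivIdeal R δ hb)))
        (Ideal.mem_sup_right (Ideal.mul_mem_mul hb (apply_mem_derivIdeal R δ ha)))
    · rw [map_add]
      exact Ideal.add_mem _ hx hy

/-- **The product rule for powers** `𝒟(I^{c+1}) ⊆ I^c · 𝒟(I)`. [cite: Kollar2007, Lemma 3.74 (2)] -/
theorem derivIdeal_pow_succ_le (I : Ideal A) (c : ℕ) :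
    derivIdeal R (I ^ (c + 1)) ≤ I ^ c * derivIdeal R I := by
  induction c with
  | zero => simp
  | succ c ih =>
    rw [pow_succ]
    refine (derivIdeal_mul_le R _ I).trans (sup_le le_rfl ?_)
    calc I * derivIdeal R (I ^ (c + 1)) ≤ I * (I ^ c * derivIdeal R I) := Ideal.mul_mono_right ih
      _ = I ^ (c + 1) * derivIdeal R I := by rw [← mul_assoc, ← pow_succ']

/-! ## Kollár's tuning notions: `MC(I)`, `D`-balanced, `MC`-invariant, `W_s(I)` (ring level) -/

/-- **The maximal contact ideal `MC(I) := D^{m-1}(I)`** of an ideal with `m = max-ord I`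
(Kollár Def. 3.79 / 3.51.2), ring level: Kollár's NAME for BGMW's tangent ideal `T(𝓘)` — this is
an alias of the tree's `tangentIdeal R I m = 𝒟^{m-1}(I)` (`CoefficientIdeals.lean`, BGMW
Def. 3.6.5), not a new notion. The intended `m` is the maximal order of `I`; for `m = 0` the
`ℕ`-subtraction gives `MC(I) = 𝒟⁰(I) = I` (harmless: `max-ord I = 0` means `I = 𝒪_X`).
[cite: Kollar2007, Def. 3.79] -/
abbrev maxContactIdeal (I : Ideal A) (m : ℕ) : Ideal A :=
  tangentIdeal R I m

/-- Unfolding the alias: `MC(I) = 𝒟^{m-1}(I)`. [cite: Kollar2007, Def. 3.79] -/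
theorem maxContactIdeal_eq (I : Ideal A) (m : ℕ) : maxContactIdeal R I m = derivIdealIter R (m - 1) I :=
  rfl

/-- **`I` is `D`-balanced** (Kollár Def. 3.83, with `m = max-ord I`):
`(D^i I)^m ⊆ I^{m-i}` for all `i < m`. [cite: Kollar2007, Def. 3.83] -/
def IsDBalanced (I : Ideal A) (m : ℕ) : Prop :=
  ∀ i < m, derivIdealIter R i I ^ m ≤ I ^ (m - i)

/-- **`I` is `MC`-invariant** (maximal contact invariant; Kollár 3.53 and p. 163, with
`m = max-ord I`): `MC(I) · D(I) ⊆ I`. [cite: Kollar2007, (3.53.1) and §3.10 (before Thm. 3.92)] -/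
def IsMCInvariant (I : Ideal A) (m : ℕ) : Prop :=
  maxContactIdeal R I m * derivIdeal R I ≤ I

/-- The weight `Σ_j (m - j) c_j` of an exponent vector `c = (c_0, …, c_m)` (Def. 3.98).
[cite: Kollar2007, Def. 3.98] -/
def coeffWeight (m : ℕ) (c : Fin (m + 1) → ℕ) : ℕ :=
  ∑ j : Fin (m + 1), (m - (j : ℕ)) * c j

/-- The monomial `∏_{j=0}^m (D^j I)^{c_j}` in the derivative ideals (Def. 3.98).
[cite: Kollar2007, Def. 3.98] -/
def derivMonomial (I : Ideal A) (m : ℕ) (c : Fin (m + 1) → ℕ) : Ideal A :=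
  ∏ j : Fin (m + 1), derivIdealIter R (j : ℕ) I ^ c j

/-- **The maximal coefficient ideal of order `s`**, `W_s(I) := (∏_{j=0}^m (D^j I)^{c_j} :
Σ (m - j) c_j ≥ s)` (Kollár Def. 3.98, with `m = max-ord I`): the ideal generated by the
monomials in the derivative ideals of weight at least `s`. [cite: Kollar2007, Def. 3.98] -/
def maxCoeffIdeal (I : Ideal A) (m s : ℕ) : Ideal A :=
  ⨆ c : {c : Fin (m + 1) → ℕ // s ≤ coeffWeight m c}, derivMonomial R I m c.1

variable {R}

/-- A monomial of weight `≥ s` lies in `W_s(I)`. [cite: Kollar2007, Def. 3.98] -/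
theorem derivMonomial_le_maxCoeffIdeal (I : Ideal A) {m s : ℕ} {c : Fin (m + 1) → ℕ}
    (hc : s ≤ coeffWeight m c) : derivMonomial R I m c ≤ maxCoeffIdeal R I m s :=
  le_iSup (fun c : {c : Fin (m + 1) → ℕ // s ≤ coeffWeight m c} => derivMonomial R I m c.1) ⟨c, hc⟩

/-- `W_s(I) ⊆ J` iff every monomial of weight `≥ s` lies in `J`. [folklore] -/
theorem maxCoeffIdeal_le_iff (I J : Ideal A) (m s : ℕ) :
    maxCoeffIdeal R I m s ≤ J ↔ ∀ c : Fin (m + 1) → ℕ, s ≤ coeffWeight m c → derivMonomial R I m c ≤ J := by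
  constructor
  · intro h c hc
    exact (derivMonomial_le_maxCoeffIdeal I hc).trans h
  · intro h
    exact iSup_le fun c => h c.1 c.2

/-- The weight is additive. [folklore] -/
theorem coeffWeight_add (m : ℕ) (c c' : Fin (m + 1) → ℕ) :
    coeffWeight m (c + c') = coeffWeight m c + coeffWeight m c' := by
  simp only [coeffWeight, Pi.add_apply, mul_add, Finset.sum_add_distrib]

/-- Monomials multiply by adding exponents. [folklore] -/
theorem derivMonomial_mul (I : Ideal A) (m : ℕ) (c c' : Fin (m + 1) → ℕ) :
    derivMonomial R I m c * derivMonomial R I m c' = derivMonomial R I m (c + c') := by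
  simp only [derivMonomial, Pi.add_apply, pow_add, Finset.prod_mul_distrib]

/-- The monomial with zero exponents is the unit ideal, so `W_0(I) = A`. [folklore] -/
theorem maxCoeffIdeal_zero (I : Ideal A) (m : ℕ) : maxCoeffIdeal R I m 0 = ⊤ := by
  refine top_le_iff.mp ((le_of_eq ?_).trans (derivMonomial_le_maxCoeffIdeal I (c := 0) (Nat.zero_le _)))
  simp only [derivMonomial, Pi.zero_apply, pow_zero, Finset.prod_const_one]
  exact Ideal.one_eq_top.symm

/-- **Prop. 3.99 (1)**: `W_{s'}(I) ⊆ W_s(I)` for `s ≤ s'`. [cite: Kollar2007, Prop. 3.99 (1)] -/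
theorem maxCoeffIdeal_antitone (I : Ideal A) (m : ℕ) {s s' : ℕ} (h : s ≤ s') :
    maxCoeffIdeal R I m s' ≤ maxCoeffIdeal R I m s :=
  (maxCoeffIdeal_le_iff I _ m s').mpr fun _ hc => derivMonomial_le_maxCoeffIdeal I (h.trans hc)

/-- **Prop. 3.99 (2)**: `W_s(I) · W_t(I) ⊆ W_{s+t}(I)`. [cite: Kollar2007, Prop. 3.99 (2)] -/
theorem maxCoeffIdeal_mul_le (I : Ideal A) (m s t : ℕ) :
    maxCoeffIdeal R I m s * maxCoeffIdeal R I m t ≤ maxCoeffIdeal R I m (s + t) := by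
  unfold maxCoeffIdeal
  rw [Ideal.iSup_mul]
  refine iSup_le fun c => ?_
  rw [Ideal.mul_iSup]
  refine iSup_le fun c' => ?_
  rw [derivMonomial_mul]
  exact derivMonomial_le_maxCoeffIdeal I (by rw [coeffWeight_add]; exact Nat.add_le_add c.2 c'.2)

/-- `I^s ⊆ W_{ms}(I)` (the monomial `(D^0 I)^s` has weight `ms`; cf. Thm. 3.100:
`I^s ⊂ J ⊂ W_{ms}(I)`). [cite: Kollar2007, Thm. 3.100] -/
theorem pow_le_maxCoeffIdeal (I : Ideal A) (m s : ℕ) : I ^ s ≤ maxCoeffIdeal R I m (m * s) := by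
  refine (le_of_eq ?_).trans (derivMonomial_le_maxCoeffIdeal I (c := Pi.single 0 s) (le_of_eq ?_))
  · rw [derivMonomial, Finset.prod_eq_single (0 : Fin (m + 1))]
    · simp
    · intro j _ hj
      simp [hj]
    · simp
  · simp [coeffWeight, Pi.single_apply]

/-- `D^j(I) ⊆ W_{m-j}(I)` for `j ≤ m` (the monomial `D^j I` has weight `m - j`); in particular
`MC(I) = D^{m-1}(I) ⊆ W_1(I)`. [cite: Kollar2007, Prop. 3.99 (4)] -/
theorem derivIdealIter_le_maxCoeffIdeal (I : Ideal A) {m : ℕ} (j : Fin (m + 1)) :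
    derivIdealIter R j I ≤ maxCoeffIdeal R I m (m - j) := by
  refine (le_of_eq ?_).trans (derivMonomial_le_maxCoeffIdeal I (c := Pi.single j 1) (le_of_eq ?_))
  · rw [derivMonomial, Finset.prod_eq_single j]
    · simp
    · intro i _ hi
      simp [hi]
    · simp
  · simp [coeffWeight, Pi.single_apply]

/-- The monomial with a single exponent. [folklore] -/
theorem derivMonomial_single (I : Ideal A) {m : ℕ} (j : Fin (m + 1)) (n : ℕ) :
    derivMonomial R I m (Pi.single j n) = derivIdealIter R j I ^ n := by
  rw [derivMonomial, Finset.prod_eq_single j]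
  · simp
  · intro i _ hi
    simp [hi]
  · simp

/-- The weight of a single exponent. [folklore] -/
theorem coeffWeight_single {m : ℕ} (j : Fin (m + 1)) (n : ℕ) :
    coeffWeight m (Pi.single j n) = (m - j) * n := by
  simp [coeffWeight, Pi.single_apply]

/-- **The product rule applied to a monomial**: `D(∏ (D^j I)^{c_j}) ⊆ W_{w-1}(I)`, `w` the
weight of `c` (each term of the product rule trades one factor `D^j I` of weight `m - j` for
`D^{j+1} I` of weight `m - j - 1`). [cite: Kollar2007, Prop. 3.99 (3)] -/
theorem derivIdeal_derivMonomial_le (I : Ideal A) (m : ℕ) :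
    ∀ (N : ℕ) (c : Fin (m + 1) → ℕ), ∑ j, c j ≤ N →
      derivIdeal R (derivMonomial R I m c) ≤ maxCoeffIdeal R I m (coeffWeight m c - 1) := by
  intro N
  induction N with
  | zero =>
    intro c hc
    have hc0 : c = 0 := by
      funext j
      exact (Finset.sum_eq_zero_iff.mp (Nat.le_zero.mp hc) j (Finset.mem_univ j))
    subst hc0
    simp [coeffWeight, maxCoeffIdeal_zero]
  | succ N ih =>
    intro c hc
    by_cases h0 : c = 0
    · subst h0
      simp [coeffWeight, maxCoeffIdeal_zero]
    obtain ⟨i, hi⟩ : ∃ i, c i ≠ 0 := by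
      by_contra h
      push Not at h
      exact h0 (funext h)
    -- split off one factor `D^i I`: `c = e_i + c'`
    set c' : Fin (m + 1) → ℕ := c - Pi.single i 1 with hc'def
    have hcc' : c = Pi.single i 1 + c' := by
      funext j
      by_cases hj : j = i
      · subst hj
        simp [hc'def]
        omega
      · simp [hc'def, hj]
    have hsum' : ∑ j, c' j ≤ N := by
      have h1 : ∑ j, c j = ∑ j, (Pi.single i 1 : Fin (m + 1) → ℕ) j + ∑ j, c' j := by
        rw [← Finset.sum_add_distrib]
        exact Finset.sum_congr rfl fun j _ => congrFun hcc' j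
      have h2 : ∑ j, (Pi.single i 1 : Fin (m + 1) → ℕ) j = 1 := by simp
      omega
    have ih' := ih c' hsum'
    have hw : coeffWeight m c = (m - i) + coeffWeight m c' := by
      rw [hcc', coeffWeight_add, coeffWeight_single, mul_one]
    rw [hcc', ← derivMonomial_mul, derivMonomial_single, pow_one]
    refine (derivIdeal_mul_le R _ _).trans (sup_le ?_ ?_)
    · -- `D^i I · D(P(c')) ⊆ W_{m-i} · W_{w'-1} ⊆ W_{w-1}`
      calc derivIdealIter R i I * derivIdeal R (derivMonomial R I m c')
          ≤ maxCoeffIdeal R I m (m - i) * maxCoeffIdeal R I m (coeffWeight m c' - 1) :=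
            Ideal.mul_mono (derivIdealIter_le_maxCoeffIdeal I i) ih'
        _ ≤ maxCoeffIdeal R I m ((m - i) + (coeffWeight m c' - 1)) := maxCoeffIdeal_mul_le I m _ _
        _ ≤ maxCoeffIdeal R I m (coeffWeight m (Pi.single i 1 + c') - 1) := by
            refine maxCoeffIdeal_antitone I m ?_
            rw [← hcc', hw]
            omega
    · -- `P(c') · D(D^i I) = P(c') · D^{i+1} I`
      rw [← derivIdealIter_succ]
      by_cases him : (i : ℕ) < m
      · -- `i < m`: this is the monomial `c' + e_{i+1}`, of weight `w - 1`
        let i₁ : Fin (m + 1) := ⟨i + 1, by omega⟩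
        have h1 : derivIdealIter R ((i : ℕ) + 1) I = derivMonomial R I m (Pi.single i₁ 1) := by
          rw [derivMonomial_single, pow_one]
        rw [h1, derivMonomial_mul]
        refine derivMonomial_le_maxCoeffIdeal I (le_of_eq ?_)
        rw [← hcc', hw, coeffWeight_add, coeffWeight_single, mul_one]
        change m - i + coeffWeight m c' - 1 = coeffWeight m c' + (m - (i + 1))
        omega
      · -- `i = m`: drop the factor `D^{m+1} I`; the weight of `c'` is that of `c`
        have him' : (i : ℕ) = m := by omega
        refine Ideal.mul_le_right.trans (derivMonomial_le_maxCoeffIdeal I ?_)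
        rw [← hcc', hw, him']
        omega

/-- **Prop. 3.99 (3), inclusion `⊆`**: `D(W_{s+1}(I)) ⊆ W_s(I)` ("follows from the product
rule"). The reverse inclusion needs a local parameter `x_1 ∈ MC(I)` and characteristic zero
and is not proved here. [cite: Kollar2007, Prop. 3.99 (3)] -/
theorem derivIdeal_maxCoeffIdeal_succ_le (I : Ideal A) (m s : ℕ) :
    derivIdeal R (maxCoeffIdeal R I m (s + 1)) ≤ maxCoeffIdeal R I m s := by
  rw [maxCoeffIdeal, derivIdeal_iSup]
  refine iSup_le fun c => ?_
  refine (derivIdeal_derivMonomial_le I m _ c.1 le_rfl).trans (maxCoeffIdeal_antitone I m ?_)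
  have := c.2
  omega

/-- Hence `D^j(W_{s+j}(I)) ⊆ W_s(I)`. [cite: Kollar2007, Prop. 3.99 (3)] -/
theorem derivIdealIter_maxCoeffIdeal_add_le (I : Ideal A) (m s j : ℕ) :
    derivIdealIter R j (maxCoeffIdeal R I m (s + j)) ≤ maxCoeffIdeal R I m s := by
  induction j generalizing s with
  | zero => simp
  | succ j ih =>
    rw [derivIdealIter_succ]
    have h := ih (s + 1)
    rw [show s + 1 + j = s + (j + 1) by omega] at h
    exact (derivIdeal_mono R h).trans (derivIdeal_maxCoeffIdeal_succ_le I m s)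

/-- **Prop. 3.99 (4), inclusions**: `MC(I) ⊆ W_1(I)` and `MC(W_s(I)) = D^{s-1}(W_s(I)) ⊆ W_1(I)`
(for the natural marking `s` of `W_s(I)`). [cite: Kollar2007, Prop. 3.99 (4)] -/
theorem maxContactIdeal_le_maxCoeffIdeal_one (I : Ideal A) {m : ℕ} (hm : 1 ≤ m) :
    maxContactIdeal R I m ≤ maxCoeffIdeal R I m 1 := by
  have h := derivIdealIter_le_maxCoeffIdeal (R := R) I (m := m) ⟨m - 1, by omega⟩
  have e : m - (m - 1) = 1 := by omega
  rw [maxContactIdeal_eq]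
  simpa [e] using h

/-- `MC(W_s(I)) ⊆ W_1(I)` for the marking `s ≥ 1` of `W_s(I)`. [cite: Kollar2007, Prop. 3.99 (4)] -/
theorem maxContactIdeal_maxCoeffIdeal_le (I : Ideal A) (m : ℕ) {s : ℕ} (hs : 1 ≤ s) :
    maxContactIdeal R (maxCoeffIdeal R I m s) s ≤ maxCoeffIdeal R I m 1 := by
  have h := derivIdealIter_maxCoeffIdeal_add_le (R := R) I m 1 (s - 1)
  rw [show 1 + (s - 1) = s by omega] at h
  rw [maxContactIdeal_eq]
  exact h

end Ring

/-! ## Sheaf level: `MC(𝓘)`, `D`-balanced, `MC`-invariant, `W_s(𝓘)` for ideal sheaves -/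

section Sheaf

open CategoryTheory _root_.AlgebraicGeometry TopologicalSpace

universe u v

variable {k : Type v} [CommRing k] {X : Scheme.{u}} (φ : k →+* Γ(X, ⊤))

/-- **The maximal contact ideal sheaf `MC(I) := D^{m-1}(I)`** (Kollár Def. 3.79, with
`m = max-ord I`): the sheaf form of the ring-level `tangentIdeal` / `maxContactIdeal` (on affine
opens its sections are `𝒟^{m-1}(I(U))`, `derivIdealSheafIter_ideal`); for `m = 0`, `MC(I) = I`
(`ℕ`-subtraction; `max-ord I = 0` means `I = 𝒪_X`). [cite: Kollar2007, Def. 3.79] -/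
abbrev maxContactIdealSheaf (I : X.IdealSheafData) (m : ℕ) : X.IdealSheafData :=
  derivIdealSheafIter φ (m - 1) I

/-- **The ideal sheaf `I` is `D`-balanced** (Kollár Def. 3.83, `m = max-ord I`):
`(D^i I)^m ⊆ I^{m-i}` for `i < m`. [cite: Kollar2007, Def. 3.83] -/
def IsDBalancedSheaf (I : X.IdealSheafData) (m : ℕ) : Prop :=
  ∀ i < m, derivIdealSheafIter φ i I ^ m ≤ I ^ (m - i)

/-- **The ideal sheaf `I` is `MC`-invariant** (Kollár 3.53 / §3.10, `m = max-ord I`):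
`MC(I) · D(I) ⊆ I`. [cite: Kollar2007, (3.53.1) and §3.10 (before Thm. 3.92)] -/
def IsMCInvariantSheaf (I : X.IdealSheafData) (m : ℕ) : Prop :=
  maxContactIdealSheaf φ I m * derivIdealSheaf φ I ≤ I

/-- The monomial `∏_{j=0}^m (D^j I)^{c_j}` in the derivative ideal sheaves (Def. 3.98).
[cite: Kollar2007, Def. 3.98] -/
def derivMonomialSheaf (I : X.IdealSheafData) (m : ℕ) (c : Fin (m + 1) → ℕ) : X.IdealSheafData :=
  ∏ j : Fin (m + 1), derivIdealSheafIter φ (j : ℕ) I ^ c j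

/-- **The maximal coefficient ideal sheaf `W_s(I)`** (Kollár Def. 3.98, `m = max-ord I`): the
ideal sheaf generated by the monomials `∏ (D^j I)^{c_j}` of weight `Σ (m - j) c_j ≥ s`.
[cite: Kollar2007, Def. 3.98] -/
def maxCoeffIdealSheaf (I : X.IdealSheafData) (m s : ℕ) : X.IdealSheafData :=
  ⨆ c : {c : Fin (m + 1) → ℕ // s ≤ coeffWeight m c}, derivMonomialSheaf φ I m c.1

/-- Multiplication of ideal sheaves distributes over suprema (sectionwise `Submodule.iSup_mul`).
[folklore] -/
theorem idealSheafData_iSup_mul {ι : Type*} (I : ι → X.IdealSheafData)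
    (J : X.IdealSheafData) : (⨆ i, I i) * J = ⨆ i, I i * J := by
  ext U : 2
  simp only [Scheme.IdealSheafData.ideal_mul, Scheme.IdealSheafData.ideal_iSup, Pi.mul_apply,
    iSup_apply, Submodule.iSup_mul]

/-- Multiplication of ideal sheaves distributes over suprema (sectionwise `Submodule.mul_iSup`).
[folklore] -/
theorem idealSheafData_mul_iSup {ι : Type*} (J : X.IdealSheafData)
    (I : ι → X.IdealSheafData) : J * (⨆ i, I i) = ⨆ i, J * I i := by
  ext U : 2
  simp only [Scheme.IdealSheafData.ideal_mul, Scheme.IdealSheafData.ideal_iSup, Pi.mul_apply,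
    iSup_apply, Submodule.mul_iSup]

/-- Sections of a finite product of ideal sheaves. [folklore] -/
theorem idealSheafData_ideal_prod {ι : Type*} (s : Finset ι) (J : ι → X.IdealSheafData)
    (U : X.affineOpens) : (∏ i ∈ s, J i).ideal U = ∏ i ∈ s, (J i).ideal U := by
  classical
  induction s using Finset.induction_on with
  | empty => simp [Scheme.IdealSheafData.ideal_top, Ideal.one_eq_top]
  | insert a s ha ih => rw [Finset.prod_insert ha, Finset.prod_insert ha, Scheme.IdealSheafData.ideal_mul, Pi.mul_apply, ih]

variable {φ}

/-- **Sections of the monomials**: `(∏ (D^j I)^{c_j})(U) = ∏ (D^j I(U))^{c_j}` (finitely presented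
differentials). [folklore] -/
theorem derivMonomialSheaf_ideal (hX : HasFinitePresentationDifferentials φ) (I : X.IdealSheafData)
    (m : ℕ) (c : Fin (m + 1) → ℕ) (U : X.affineOpens) :
    (derivMonomialSheaf φ I m c).ideal U =
      (letI := sectionsAlgebra φ U; derivMonomial k (I.ideal U) m c) := by
  letI := sectionsAlgebra φ U
  rw [derivMonomialSheaf, idealSheafData_ideal_prod, derivMonomial]
  refine Finset.prod_congr rfl fun j _ => ?_
  rw [Scheme.IdealSheafData.ideal_pow, Pi.pow_apply, derivIdealSheafIter_ideal hX]

/-- **Sections of `W_s(I)`**: `W_s(I)(U) = W_s(I(U))` on affine opens (finitely presented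
differentials). [cite: Kollar2007, Def. 3.98] -/
theorem maxCoeffIdealSheaf_ideal (hX : HasFinitePresentationDifferentials φ) (I : X.IdealSheafData)
    (m s : ℕ) (U : X.affineOpens) :
    (maxCoeffIdealSheaf φ I m s).ideal U =
      (letI := sectionsAlgebra φ U; maxCoeffIdeal k (I.ideal U) m s) := by
  letI := sectionsAlgebra φ U
  rw [maxCoeffIdealSheaf, Scheme.IdealSheafData.ideal_iSup, iSup_apply, maxCoeffIdeal]
  exact iSup_congr fun c => derivMonomialSheaf_ideal hX I m c.1 U

variable (φ)

/-- A monomial of weight `≥ s` lies in `W_s(I)`. [cite: Kollar2007, Def. 3.98] -/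
theorem derivMonomialSheaf_le_maxCoeffIdealSheaf (I : X.IdealSheafData) {m s : ℕ}
    {c : Fin (m + 1) → ℕ} (hc : s ≤ coeffWeight m c) :
    derivMonomialSheaf φ I m c ≤ maxCoeffIdealSheaf φ I m s :=
  le_iSup (fun c : {c : Fin (m + 1) → ℕ // s ≤ coeffWeight m c} => derivMonomialSheaf φ I m c.1)
    ⟨c, hc⟩

/-- Monomials multiply by adding exponents. [folklore] -/
theorem derivMonomialSheaf_mul (I : X.IdealSheafData) (m : ℕ) (c c' : Fin (m + 1) → ℕ) :
    derivMonomialSheaf φ I m c * derivMonomialSheaf φ I m c' = derivMonomialSheaf φ I m (c + c') := by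
  simp only [derivMonomialSheaf, Pi.add_apply, pow_add, Finset.prod_mul_distrib]

/-- **Prop. 3.99 (1)** for ideal sheaves: `W_{s'}(I) ⊆ W_s(I)` for `s ≤ s'`.
[cite: Kollar2007, Prop. 3.99 (1)] -/
theorem maxCoeffIdealSheaf_antitone (I : X.IdealSheafData) (m : ℕ) {s s' : ℕ} (h : s ≤ s') :
    maxCoeffIdealSheaf φ I m s' ≤ maxCoeffIdealSheaf φ I m s :=
  iSup_le fun c => derivMonomialSheaf_le_maxCoeffIdealSheaf φ I (h.trans c.2)

/-- **Prop. 3.99 (2)** for ideal sheaves: `W_s(I) · W_t(I) ⊆ W_{s+t}(I)`.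
[cite: Kollar2007, Prop. 3.99 (2)] -/
theorem maxCoeffIdealSheaf_mul_le (I : X.IdealSheafData) (m s t : ℕ) :
    maxCoeffIdealSheaf φ I m s * maxCoeffIdealSheaf φ I m t ≤ maxCoeffIdealSheaf φ I m (s + t) := by
  unfold maxCoeffIdealSheaf
  rw [idealSheafData_iSup_mul]
  refine iSup_le fun c => ?_
  rw [idealSheafData_mul_iSup]
  refine iSup_le fun c' => ?_
  rw [derivMonomialSheaf_mul]
  exact derivMonomialSheaf_le_maxCoeffIdealSheaf φ I
    (by rw [coeffWeight_add]; exact Nat.add_le_add c.2 c'.2)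

/-- `I^s ⊆ W_{ms}(I)`. [cite: Kollar2007, Thm. 3.100] -/
theorem pow_le_maxCoeffIdealSheaf (I : X.IdealSheafData) (m s : ℕ) :
    I ^ s ≤ maxCoeffIdealSheaf φ I m (m * s) := by
  refine (le_of_eq ?_).trans
    (derivMonomialSheaf_le_maxCoeffIdealSheaf φ I (c := Pi.single 0 s) (le_of_eq ?_))
  · rw [derivMonomialSheaf, Finset.prod_eq_single (0 : Fin (m + 1))]
    · simp
    · intro j _ hj
      simp [hj]
    · simp
  · simp [coeffWeight, Pi.single_apply]

variable {φ}

/-- **Prop. 3.99 (3), inclusion `⊆`, for ideal sheaves**: `D(W_{s+1}(I)) ⊆ W_s(I)` (finitely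
presented differentials, e.g. `X` a variety). [cite: Kollar2007, Prop. 3.99 (3)] -/
theorem derivIdealSheaf_maxCoeffIdealSheaf_succ_le (hX : HasFinitePresentationDifferentials φ)
    (I : X.IdealSheafData) (m s : ℕ) :
    derivIdealSheaf φ (maxCoeffIdealSheaf φ I m (s + 1)) ≤ maxCoeffIdealSheaf φ I m s := by
  intro U
  letI := sectionsAlgebra φ U
  rw [derivIdealSheaf_ideal hX, maxCoeffIdealSheaf_ideal hX, maxCoeffIdealSheaf_ideal hX]
  exact derivIdeal_maxCoeffIdeal_succ_le (I.ideal U) m s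

/-- `D`-balancedness and `MC`-invariance of an ideal sheaf are those of its sections on affine
opens (finitely presented differentials). [folklore] -/
theorem isMCInvariantSheaf_iff (hX : HasFinitePresentationDifferentials φ) (I : X.IdealSheafData)
    (m : ℕ) : IsMCInvariantSheaf φ I m ↔
      ∀ U : X.affineOpens, letI := sectionsAlgebra φ U; IsMCInvariant k (I.ideal U) m := by
  refine forall_congr' fun U => ?_
  letI := sectionsAlgebra φ U
  rw [Scheme.IdealSheafData.ideal_mul, Pi.mul_apply, derivIdealSheafIter_ideal hX,
    derivIdealSheaf_ideal hX]
  rfl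

/-- `D`-balancedness on affine opens. [folklore] -/
theorem isDBalancedSheaf_iff (hX : HasFinitePresentationDifferentials φ) (I : X.IdealSheafData)
    (m : ℕ) : IsDBalancedSheaf φ I m ↔
      ∀ U : X.affineOpens, letI := sectionsAlgebra φ U; IsDBalanced k (I.ideal U) m := by
  constructor
  · intro h U i hi
    have := h i hi U
    rwa [Scheme.IdealSheafData.ideal_pow, Pi.pow_apply, derivIdealSheafIter_ideal hX,
      Scheme.IdealSheafData.ideal_pow, Pi.pow_apply] at this
  · intro h i hi U
    rw [Scheme.IdealSheafData.ideal_pow, Pi.pow_apply, derivIdealSheafIter_ideal hX,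
      Scheme.IdealSheafData.ideal_pow, Pi.pow_apply]
    exact h U i hi

end Sheaf

end Literature.AlgebraicGeometry.Resolution
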